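import Summits.Ventures.HSemireg.WedgeHankelRecurrenceGaussChebyshevNestedRules
import Mathlib.RingTheory.Polynomial.Dickson

/-!
# Venture HSemireg — **THE CHEBYSHEV–FERMAT CONGRUENCES: `T_p = X^p`, `C_p = X^p`, `T_{p^k} = X^{p^k}`, `C_{p^k} = X^{p^k}` IN EVERY COMMUTATIVE RING OF ODD PRIME CHARACTERISTIC `p`**
# (for `C` also `p = 2`), hence `T_p(x) ≡ x (mod p)` for integers `x` and `T_{np} = T_n` as functions on `𝔽_p` — Mathlib's Dickson identity `D_p(x,1) = x^p` in characteristic `p` transported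
# through `C_n = D_n(·,1)` and `C_n(2X) = 2 T_n` (with `2^{p−1} = 1`), then composed by `T_{mn} = T_m ∘ T_n`

HONEST FRAMING. Part of the Lean index of the computation cell `pub-hsemireg` (seat p10 gen 48, Sunday typer «UNIFORM-IN-n»).  Polynomial algebra in characteristic `p` only; no variety, no
cohomology theory, no sheaf, no Ext group and no semiregularity map is constructed here; nothing here says that HC / HC_CM / HC_AV holds; no Literature fact (unproved `Prop`) is declared or
used.  Custodian versions as in `WedgeHankelSiegelIdeal` (1/3).
SOURCES (cited).  I. Schur, *Arithmetisches über die Tschebyscheffschen Polynome*, Math. Ann. 165 (1931) (congruences for `T_n` modulo primes); R. Lidl, G. L. Mullen, G. Turnwald, *Dickson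
Polynomials* (1993), Ch. 2 (`D_p(x, a) ≡ x^p`); T. J. Rivlin, *Chebyshev Polynomials* (1990), §5.2 (number-theoretic properties).  Mathlib: `Polynomial.dickson_one_one_charP`.
PROOF TYPED HERE.  Mathlib `Polynomial.dickson_one_one_eq_chebyshev_C`, `Polynomial.dickson_one_one_charP`, `Polynomial.Chebyshev.C_comp_two_mul_X`, `T_mul`, `C_mul`, `X_pow_comp`,
`ZMod.pow_card_sub_one_eq_one`, `ZMod.pow_card`, `IsUnit.of_pow_eq_one`, `map_T`.
DEDUP DISCLOSURE (`rg -n 'chebyshevC_eq_X_pow|chebyshevT_eq_X_pow|two_pow_sub_one_eq_one_of_charP|chebyshevT_eval_zmod|chebyshevT_mul_prime_eval|chebyshevT_int_eval_modEq' Summits Literature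
HarnessLib`, 2026-09-04): Mathlib states the Dickson form only; 0 hits for the 8 names below.

WHAT IS IN THE TREE.  Mathlib `Dickson`; the chapter's `T`, `C` toolkit.
THIS FILE (namespace `Summit.Ventures.HSemireg.Wedge.HankelOuter` continued; CHAINED on N472; 0 definitions):
* §1238 **`chebyshevC_eq_X_pow_charP`**, `two_pow_sub_one_eq_one_of_charP`, **`chebyshevT_eq_X_pow_charP`**, **`chebyshevT_eq_X_pow_pow_charP`**, **`chebyshevC_eq_X_pow_pow_charP`**,
  `chebyshevT_eval_zmod_prime`, `chebyshevT_mul_prime_eval_zmod`, `chebyshevT_int_eval_modEq`.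
CAVEATS.  `p` odd for the `T`-statements (`T_2 = 2X² − 1 = 1 ≠ X²` over `𝔽₂`).  Nothing Ext-side.  New names only.
-/

open Module Polynomial
open scoped Matrix Polynomial

namespace Summit.Ventures.HSemireg.Wedge.HankelOuter

/-! ## §1238. Chebyshev–Fermat congruences -/

/-- **`C_p = X^p` in every commutative ring of prime characteristic `p`** (Dickson `D_p(x,1) = x^p`). [Lidl–Mullen–Turnwald Ch. 2; Mathlib `dickson_one_one_charP`; this file, §1238] -/
theorem chebyshevC_eq_X_pow_charP (R : Type*) [CommRing R] (p : ℕ) [Fact p.Prime] [CharP R p] :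
    Polynomial.Chebyshev.C R (p : ℤ) = Polynomial.X ^ p := by
  rw [← Polynomial.dickson_one_one_eq_chebyshev_C, Polynomial.dickson_one_one_charP]

/-- `2^{p−1} = 1` in a commutative ring of odd prime characteristic `p` (Fermat). [this file, §1238] -/
theorem two_pow_sub_one_eq_one_of_charP (R : Type*) [CommRing R] (p : ℕ) [hp : Fact p.Prime] [CharP R p] (hp2 : p ≠ 2) : (2 : R) ^ (p - 1) = 1 := by
  have h2 : (2 : ZMod p) ≠ 0 := by
    intro h
    have h' : ((2 : ℕ) : ZMod p) = 0 := by exact_mod_cast h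
    rw [ZMod.natCast_eq_zero_iff] at h'
    have := Nat.le_of_dvd (by norm_num) h'
    have := hp.out.two_le
    omega
  have h := ZMod.pow_card_sub_one_eq_one h2
  have e := congrArg (ZMod.castHom (dvd_refl p) R) h
  rw [map_pow, map_one, map_ofNat] at e
  exact e

/-- **`T_p = X^p` in every commutative ring of odd prime characteristic `p`** (Schur's congruence `T_p(x) ≡ x^p (mod p)`). [Schur; Rivlin §5.2; this file, §1238] -/
theorem chebyshevT_eq_X_pow_charP (R : Type*) [CommRing R] (p : ℕ) [hp : Fact p.Prime] [CharP R p] (hp2 : p ≠ 2) :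
    Polynomial.Chebyshev.T R (p : ℤ) = Polynomial.X ^ p := by
  have h := Polynomial.Chebyshev.C_comp_two_mul_X R (p : ℤ)
  rw [chebyshevC_eq_X_pow_charP R p, Polynomial.X_pow_comp, mul_pow] at h
  -- `h : 2^p X^p = 2 T_p`; `2^p = 2 · 2^{p−1} = 2` and `2` is a unit
  have hp1 : p - 1 ≠ 0 := by have := hp.out.two_le; omega
  have hpow : (2 : R[X]) ^ p = 2 := by
    rw [show p = (p - 1) + 1 by omega, pow_succ, show (2 : R[X]) = Polynomial.C 2 from (Polynomial.C_ofNat 2).symm, ← map_pow, two_pow_sub_one_eq_one_of_charP R p hp2,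
      map_one, one_mul]
  have hunit : IsUnit (2 : R[X]) := by
    rw [show (2 : R[X]) = Polynomial.C 2 from (Polynomial.C_ofNat 2).symm]
    exact Polynomial.isUnit_C.2 (IsUnit.of_pow_eq_one (two_pow_sub_one_eq_one_of_charP R p hp2) hp1)
  rw [hpow] at h
  exact (hunit.mul_right_inj.1 h).symm

/-- **`T_{p^k} = X^{p^k}` in every commutative ring of odd prime characteristic `p`** (`T_{mn} = T_m ∘ T_n`). [this file, §1238] -/
theorem chebyshevT_eq_X_pow_pow_charP (R : Type*) [CommRing R] (p : ℕ) [Fact p.Prime] [CharP R p] (hp2 : p ≠ 2) (k : ℕ) :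
    Polynomial.Chebyshev.T R ((p ^ k : ℕ) : ℤ) = Polynomial.X ^ (p ^ k) := by
  induction k with
  | zero => rw [pow_zero, Nat.cast_one, Polynomial.Chebyshev.T_one, pow_one]
  | succ k ih => rw [pow_succ, Nat.cast_mul, Polynomial.Chebyshev.T_mul, ih, chebyshevT_eq_X_pow_charP R p hp2, Polynomial.X_pow_comp, ← pow_mul, mul_comm]

/-- **`C_{p^k} = X^{p^k}` in every commutative ring of prime characteristic `p`** (`C_{mn} = C_m ∘ C_n`). [this file, §1238] -/
theorem chebyshevC_eq_X_pow_pow_charP (R : Type*) [CommRing R] (p : ℕ) [Fact p.Prime] [CharP R p] (k : ℕ) :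
    Polynomial.Chebyshev.C R ((p ^ k : ℕ) : ℤ) = Polynomial.X ^ (p ^ k) := by
  induction k with
  | zero => rw [pow_zero, Nat.cast_one, Polynomial.Chebyshev.C_one, pow_one]
  | succ k ih => rw [pow_succ, Nat.cast_mul, Polynomial.Chebyshev.C_mul, ih, chebyshevC_eq_X_pow_charP R p, Polynomial.X_pow_comp, ← pow_mul, mul_comm]

/-- `T_p(x) = x` for every `x ∈ 𝔽_p` (`p` odd). [Fermat; this file, §1238] -/
theorem chebyshevT_eval_zmod_prime (p : ℕ) [Fact p.Prime] (hp2 : p ≠ 2) (x : ZMod p) : (Polynomial.Chebyshev.T (ZMod p) (p : ℤ)).eval x = x := by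
  rw [chebyshevT_eq_X_pow_charP (ZMod p) p hp2, eval_pow, eval_X, ZMod.pow_card]

/-- **`T_{np}` and `T_n` agree as functions on `𝔽_p`** (`p` odd): `T_{np}(x) = T_n(T_p(x)) = T_n(x)`. [this file, §1238] -/
theorem chebyshevT_mul_prime_eval_zmod (p : ℕ) [Fact p.Prime] (hp2 : p ≠ 2) (n : ℤ) (x : ZMod p) :
    (Polynomial.Chebyshev.T (ZMod p) (n * p)).eval x = (Polynomial.Chebyshev.T (ZMod p) n).eval x := by
  rw [Polynomial.Chebyshev.T_mul, eval_comp, chebyshevT_eval_zmod_prime p hp2]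

/-- **`T_p(x) ≡ x (mod p)` for every integer `x`** (`p` an odd prime). [Schur; Rivlin §5.2; this file, §1238] -/
theorem chebyshevT_int_eval_modEq (p : ℕ) [Fact p.Prime] (hp2 : p ≠ 2) (x : ℤ) : (Polynomial.Chebyshev.T ℤ (p : ℤ)).eval x ≡ x [ZMOD p] := by
  rw [← ZMod.intCast_eq_intCast_iff]
  have h := Polynomial.eval_intCast_map (Int.castRingHom (ZMod p)) (Polynomial.Chebyshev.T ℤ (p : ℤ)) x
  rw [Polynomial.Chebyshev.map_T, chebyshevT_eval_zmod_prime p hp2, eq_intCast] at h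
  exact h.symm

end Summit.Ventures.HSemireg.Wedge.HankelOuter
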